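import Summits.AtomisticToContinuum.FouriersLaw.Theorems.EmbeddedDrudeMourreFGRGapEssGapC
import Summits.AtomisticToContinuum.FouriersLaw.Theorems.EmbeddedDrudeMourreFGRGapEssGapD
import Summits.AtomisticToContinuum.FouriersLaw.Theorems.EmbeddedDrudeMourreFGRGapGenericA

/-!
# `FGRGap`, line fold-jet-rigidity, stub `stub_oddEssentialGap` — part E: the coordinate-pair charts

Helper file for the crux `Summit.AtomisticToContinuum.FouriersLaw.Theses.EmbeddedDrudeMourre.FGRGap`
(item `stmt-AtomisticToContinuum-12595`), registered stub `stub_oddEssentialGap` (sequel of parts A–D).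

For a lift `φ` of the partner map with `Dφ(p) = c₁(p) dk₁ + c₃(p) dk₃` (the GA implicit derivatives,
`c₁ = (v₄-v₁)/(v₂-v₄)`, `c₃ = (v₃-v₄)/(v₂-v₄)`), the two COORDINATE-PAIR CHARTS of the resonant surface
through the first momentum,

  `Ψ₂ p = (k₁, φ p)`      with `DΨ₂ = [1 0; c₁ c₃]`,      `det = c₃`,
  `Ψ₄ p = (k₁, k₁+φ p-k₃)` with `DΨ₄ = [1 0; 1+c₁ c₃-1]`,  `det = c₃ - 1`,

are local diffeomorphisms wherever `c₃ ≠ 0` resp. `c₃ ≠ 1` (i.e. `v₃ ≠ v₄` resp. `v₂ ≠ v₃`: general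
position). This file provides: the derivative matrices as continuous linear maps with their determinants
(`chart2_det`, `chart4_det`), the strict derivatives of `Ψ₂, Ψ₄` (`hasStrictFDerivAt_chart2/4`), the
associated `OpenPartialHomeomorph`s from the inverse function theorem (`exists_openPartialHomeomorph_chart`),
and the continuity of the collision weight `p ↦ w(k₁, φ p, k₃)` at points where the resolved Jacobian does not
vanish (`continuousAt_collisionWeight_lift`). Folklore; no named facts.
-/

noncomputable section

open MeasureTheory Set Real Filter Topology
open scoped ENNReal
open Literature.MathematicalPhysics.KineticTheory.PhononBoltzmann

namespace Summit.AtomisticToContinuum.FouriersLaw.Theorems.FGRGap.FoldJetRigidity.EssGap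

/-- The lower-triangular derivative matrix `[1 0; α β]` of a coordinate-pair chart, as a continuous linear
map of `ℝ × ℝ`. -/
local notation3 "chartCLM[" α ", " β "]" =>
  LinearMap.toContinuousLinearMap (Matrix.toLin (Module.Basis.finTwoProd ℝ) (Module.Basis.finTwoProd ℝ)
    !![(1 : ℝ), 0; α, β])

/-! ## 1. The derivative matrices -/

/-- `[1 0; α β] (u, v) = (u, αu + βv)`. [folklore] -/
theorem chartCLM_apply (α β : ℝ) (x : ℝ × ℝ) : chartCLM[α, β] x = (x.1, α * x.1 + β * x.2) := by
  rw [LinearMap.coe_toContinuousLinearMap', Matrix.toLin_finTwoProd_apply]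
  simp

/-- `det [1 0; α β] = β`. [folklore] -/
theorem chartCLM_det (α β : ℝ) : (chartCLM[α, β]).det = β := by
  rw [ContinuousLinearMap.det, LinearMap.coe_toContinuousLinearMap, LinearMap.det_toLin,
    Matrix.det_fin_two_of]
  ring

/-- `[1 0; α β]` as `fst.prod (α•fst + β•snd)`. [folklore] -/
theorem chartCLM_eq (α β : ℝ) :
    chartCLM[α, β] = (ContinuousLinearMap.fst ℝ ℝ ℝ).prod
      (α • ContinuousLinearMap.fst ℝ ℝ ℝ + β • ContinuousLinearMap.snd ℝ ℝ ℝ) := by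
  ext <;> simp [chartCLM_apply]

/-- **Strict derivative of the chart `Ψ₂ p = (k₁, φ p)`**: if `Dφ = c₁ dk₁ + c₃ dk₃` then
`DΨ₂ = [1 0; c₁ c₃]`. [folklore] -/
theorem hasStrictFDerivAt_chart2 {φ : ℝ × ℝ → ℝ} {p : ℝ × ℝ} {c₁ c₃ : ℝ}
    (hφ : HasStrictFDerivAt φ (c₁ • ContinuousLinearMap.fst ℝ ℝ ℝ + c₃ • ContinuousLinearMap.snd ℝ ℝ ℝ) p) :
    HasStrictFDerivAt (fun q : ℝ × ℝ => (q.1, φ q)) (chartCLM[c₁, c₃]) p := by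
  rw [chartCLM_eq]
  exact hasStrictFDerivAt_fst.prodMk hφ

/-- **Strict derivative of the chart `Ψ₄ p = (k₁, k₁ + φ p - k₃)`**: `DΨ₄ = [1 0; 1+c₁ c₃-1]`.
[folklore] -/
theorem hasStrictFDerivAt_chart4 {φ : ℝ × ℝ → ℝ} {p : ℝ × ℝ} {c₁ c₃ : ℝ}
    (hφ : HasStrictFDerivAt φ (c₁ • ContinuousLinearMap.fst ℝ ℝ ℝ + c₃ • ContinuousLinearMap.snd ℝ ℝ ℝ) p) :
    HasStrictFDerivAt (fun q : ℝ × ℝ => (q.1, q.1 + φ q - q.2)) (chartCLM[1 + c₁, c₃ - 1]) p := by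
  have h : HasStrictFDerivAt (fun q : ℝ × ℝ => q.1 + φ q - q.2)
      (ContinuousLinearMap.fst ℝ ℝ ℝ + (c₁ • ContinuousLinearMap.fst ℝ ℝ ℝ +
        c₃ • ContinuousLinearMap.snd ℝ ℝ ℝ) - ContinuousLinearMap.snd ℝ ℝ ℝ) p :=
    (hasStrictFDerivAt_fst.add hφ).sub hasStrictFDerivAt_snd
  have e : chartCLM[1 + c₁, c₃ - 1] = (ContinuousLinearMap.fst ℝ ℝ ℝ).prod
      (ContinuousLinearMap.fst ℝ ℝ ℝ + (c₁ • ContinuousLinearMap.fst ℝ ℝ ℝ +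
        c₃ • ContinuousLinearMap.snd ℝ ℝ ℝ) - ContinuousLinearMap.snd ℝ ℝ ℝ) := by
    ext <;> simp [chartCLM_apply]
  rw [e]
  exact hasStrictFDerivAt_fst.prodMk h

/-! ## 2. The charts as open partial homeomorphisms -/

/-- **Inverse function theorem for a coordinate-pair chart**: a map with strict derivative `[1 0; α β]`,
`β ≠ 0`, at `p₀` coincides with an `OpenPartialHomeomorph` whose source contains `p₀`. [folklore] -/
theorem exists_openPartialHomeomorph_chart {Ψ : ℝ × ℝ → ℝ × ℝ} {p₀ : ℝ × ℝ} {α β : ℝ}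
    (hΨ : HasStrictFDerivAt Ψ (chartCLM[α, β]) p₀) (hβ : β ≠ 0) :
    ∃ e : OpenPartialHomeomorph (ℝ × ℝ) (ℝ × ℝ), (∀ p, e p = Ψ p) ∧ p₀ ∈ e.source := by
  have hdet : (chartCLM[α, β]).det ≠ 0 := by rw [chartCLM_det]; exact hβ
  set L : (ℝ × ℝ) ≃L[ℝ] (ℝ × ℝ) := (chartCLM[α, β]).toContinuousLinearEquivOfDetNeZero hdet with hL
  have hΨ' : HasStrictFDerivAt Ψ (L : ℝ × ℝ →L[ℝ] ℝ × ℝ) p₀ := by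
    rw [hL, ContinuousLinearMap.coe_toContinuousLinearEquivOfDetNeZero]; exact hΨ
  exact ⟨hΨ'.toOpenPartialHomeomorph Ψ, fun p => rfl, hΨ'.mem_toOpenPartialHomeomorph_source⟩

/-! ## 3. Continuity of the lifted collision weight -/

/-- The vertex is continuous in its three momenta. [folklore] -/
theorem continuous_vertex (a b : ℝ) : Continuous (fun q : ℝ × ℝ × ℝ => vertex a b q.1 q.2.1 q.2.2) := by
  unfold vertex; fun_prop

/-- **Continuity of the collision weight** `(k₁,k₂,k₃) ↦ w(k₁,k₂,k₃)` at every point where the resolved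
Jacobian `|v(k₂) - v(k₁+k₂-k₃)|` does not vanish (`ω₂ > 0`). [folklore] -/
theorem continuousAt_collisionWeight {ω₂ : ℝ} (hω : 0 < ω₂) (a b : ℝ) {q : ℝ × ℝ × ℝ}
    (hq : groupVelocity ω₂ q.2.1 ≠ groupVelocity ω₂ (q.1 + q.2.1 - q.2.2)) :
    ContinuousAt (fun q : ℝ × ℝ × ℝ => collisionWeight ω₂ a b q.1 q.2.1 q.2.2) q := by
  unfold collisionWeight resonanceJacobian
  have hv := Generic.continuous_groupVelocity hω
  have hd := (Generic.continuous_dispersion (ω₂ := ω₂))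
  refine ContinuousAt.div ?_ ?_ ?_
  · refine ContinuousAt.div (((continuous_vertex a b).pow 2).const_mul _).continuousAt ?_ ?_
    · exact ((((hd.comp continuous_fst).mul (hd.comp (continuous_fst.comp continuous_snd))).mul
        (hd.comp (continuous_snd.comp continuous_snd))).mul (hd.comp (by fun_prop))).continuousAt.pow 2
    · have h1 := dispersion_pos hω q.1
      have h2 := dispersion_pos hω q.2.1
      have h3 := dispersion_pos hω q.2.2
      have h4 := dispersion_pos hω (q.1 + q.2.1 - q.2.2)
      positivity
  · exact ((hv.comp (continuous_fst.comp continuous_snd)).sub (hv.comp (by fun_prop))).continuousAt.abs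
  · exact abs_ne_zero.mpr (sub_ne_zero.mpr hq)

/-- **Continuity of the lifted weight** `p ↦ w(k₁, φ p, k₃)` at a point where `φ` is continuous and the
resolved Jacobian does not vanish. [folklore] -/
theorem continuousAt_collisionWeight_lift {ω₂ : ℝ} (hω : 0 < ω₂) (a b : ℝ) {φ : ℝ × ℝ → ℝ}
    {p : ℝ × ℝ} (hφ : ContinuousAt φ p)
    (hp : groupVelocity ω₂ (φ p) ≠ groupVelocity ω₂ (p.1 + φ p - p.2)) :
    ContinuousAt (fun p : ℝ × ℝ => collisionWeight ω₂ a b p.1 (φ p) p.2) p := by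
  have hc : ContinuousAt (fun p : ℝ × ℝ => (p.1, φ p, p.2)) p :=
    continuousAt_fst.prodMk (hφ.prodMk continuousAt_snd)
  exact ContinuousAt.comp (f := fun p : ℝ × ℝ => (p.1, φ p, p.2))
    (g := fun q : ℝ × ℝ × ℝ => collisionWeight ω₂ a b q.1 q.2.1 q.2.2)
    (continuousAt_collisionWeight hω a b (q := (p.1, φ p, p.2)) hp) hc

/-- **Positivity of the collision weight** at a point with non-vanishing vertex and non-vanishing resolved
Jacobian (`ω₂ > 0`). [folklore] -/
theorem collisionWeight_pos {ω₂ : ℝ} (hω : 0 < ω₂) {a b k₁ k₂ k₃ : ℝ} (hv : vertex a b k₁ k₂ k₃ ≠ 0)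
    (hj : groupVelocity ω₂ k₂ ≠ groupVelocity ω₂ (k₁ + k₂ - k₃)) : 0 < collisionWeight ω₂ a b k₁ k₂ k₃ := by
  unfold collisionWeight resonanceJacobian
  have h1 := dispersion_pos hω k₁
  have h2 := dispersion_pos hω k₂
  have h3 := dispersion_pos hω k₃
  have h4 := dispersion_pos hω (k₁ + k₂ - k₃)
  have hv2 : 0 < vertex a b k₁ k₂ k₃ ^ 2 := by positivity
  have hj' : 0 < |groupVelocity ω₂ k₂ - groupVelocity ω₂ (k₁ + k₂ - k₃)| := abs_pos.mpr (sub_ne_zero.mpr hj)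
  have := alsPrefactor_pos
  positivity

/-- The unit vertex controls every vertex: `vertex a b = a · vertex 1 (b/a)` (`a ≠ 0`). [folklore] -/
theorem vertex_eq_mul_vertex_one {a : ℝ} (ha : a ≠ 0) (b k₁ k₂ k₃ : ℝ) :
    vertex a b k₁ k₂ k₃ = a * vertex 1 (b / a) k₁ k₂ k₃ := by
  unfold vertex; field_simp

end Summit.AtomisticToContinuum.FouriersLaw.Theorems.FGRGap.FoldJetRigidity.EssGap

namespace Summit.AtomisticToContinuum.FouriersLaw.Theorems.FGRGap.FoldJetRigidity

/-- REGISTERED HELPER STUB `stub_oddEssentialGap_partE` (landing vehicle of this file): coordinate-pair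
charts (p ↦ (p.1, φ p), p ↦ (p.1, p.1 + φ p − p.2)) as OpenPartialHomeomorphs with explicit
Jacobians; continuity and positivity of the collision weight off the Jacobian-degenerate set.
[folklore] -/
theorem stub_oddEssentialGap_partE :
    ∀ ω₂ : ℝ, 0 < ω₂ → ∀ (a b : ℝ) (q : ℝ × ℝ × ℝ),
      groupVelocity ω₂ q.2.1 ≠ groupVelocity ω₂ (q.1 + q.2.1 - q.2.2) →
        ContinuousAt (fun q : ℝ × ℝ × ℝ => collisionWeight ω₂ a b q.1 q.2.1 q.2.2) q :=
  fun _ω₂ hω a b _q hq => EssGap.continuousAt_collisionWeight hω a b hq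

end Summit.AtomisticToContinuum.FouriersLaw.Theorems.FGRGap.FoldJetRigidity

end
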